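import Mathlib
import HarnessLib
import Literature.Computability.AlgebraicComplexity.AsymptoticSpectrumDuality
import Literature.Computability.AlgebraicComplexity.AsymptoticRankMatMul
import Literature.Computability.AlgebraicComplexity.AlmanLi2026SpectrumMatMul
import Summits.MatrixMultiplication.MatrixMultiplication.Theorems.OutsiderSandwichGluingGain
import Summits.MatrixMultiplication.MatrixMultiplication.Theorems.OutsiderSandwichTraceDefect

/-!
# Outsider sandwich — the trace defect in GAIN coordinates, and `|R̃(C₁) − 2^ω| ≤ 2`
# (decomp-mm lens-4, g22, part 1b)

Companion of `OutsiderSandwichTraceDefect` (supporting item `stmt-MatrixMultiplication-27147`,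
`BlockOneIsMM`; cut of record UNCHANGED).  From the one-letter sandwich
`2^{τ} − 2^{θ₁} ≤ F(C₁) ≤ 2^{τ} + 2^{θ₁}` proved there (`τ = θ₀+θ₁+θ₂`):

* **gain coordinates** (`gain F = log₂ F(C₁) − θ₀ − θ₂`, g21):
  `2^{θ₁} · (1 − 2^{−(θ₀+θ₂)}) ≤ 2^{gain F} ≤ 2^{θ₁} · (1 + 2^{−(θ₀+θ₂)})`, with
  `2^{−(θ₀+θ₂)} ≤ 1/2` (`θ₀ + θ₂ ≥ 1` at every universal point); log forms
  `θ₁ + log₂(1 − 2^{−(θ₀+θ₂)}) ≤ gain F ≤ θ₁ + log₂(1 + 2^{−(θ₀+θ₂)})` — the leaf `θ₁ ≤ gain F`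
  (`BlockOneIsMM` at `F`) and its converse `gain F ≤ θ₁` (`BlockBelowMM` at `F`) each fail by at most
  `|log₂(1 ∓ 2^{−(θ₀+θ₂)})| ≤ 1`, resp. `≤ log₂(3/2)`;
* **the minimal counterexample pays its excess out of one letter**:
  `logRatio F ≤ −log₂(1 − 2^{θ₁ − τ})` at every universal point (so at the extremal point `F⋆`,
  `θ⋆ ≤ −log₂(1 − 2^{θ₁(F⋆) − τ(F⋆)})`);
* **`|R̃(C₁) − 2^ω| ≤ 2`** by Strassen duality at the points attaining `R̃⟨2,2,2⟩ = 2^ω` and `R̃(C₁)`.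

Honest tag (memo NODE-g22): at the record window these bounds are numerically dominated by
`4 ≤ F(C₁)` / `R̃(C₁) ≤ 6`; their content is the STRUCTURE of the defect (one `⟨1,2,1⟩`).

[ChristandlVranaZuiddam2023, Prop. 1.6]; [AlmanLi2026, Prop. 4.1–4.2]; [Strassen1988, Thm. 3.8].
-/

noncomputable section

open Literature.Computability.AlgebraicComplexity
open Summit.MatrixMultiplication.MatrixMultiplication.Theorems.OutsiderSandwichCoupling (coupling₁)
open Summit.MatrixMultiplication.MatrixMultiplication.Theorems.OutsiderSandwichExchangeSpectral
  (logRatio map_matMul_eq_rpow map_matMul_le_rpow_omega)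
open Summit.MatrixMultiplication.MatrixMultiplication.Theorems.OutsiderSandwichGluingGain
  (gain map_coupling₁_pos)
open Summit.MatrixMultiplication.MatrixMultiplication.Theorems.OutsiderSandwichTraceDefect

namespace Summit.MatrixMultiplication.MatrixMultiplication.Theorems.OutsiderSandwichTraceDefectGain

variable {F : SpectralMap ℂ}

/-! ## 1. Gain coordinates: `2^{gain F} = 2^{θ₁} · (1 ± 2^{−(θ₀+θ₂)})` -/

/-- `θ₀ + θ₂ ≥ 1` at every universal point (`Σθᵢ ≥ 2`, `θ₁ ≤ 1`). [cite: AlmanLi2026, Prop. 4.2] -/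
theorem one_le_specMMPoint_add (hF : IsUniversalSpectralPoint ℂ F) :
    1 ≤ specMMPoint ℂ F 0 + specMMPoint ℂ F 2 := by
  have h2 := AlmanLi2026.prop42_two_le_sum hF
  have h1 := (AlmanLi2026.prop42_mem_Icc hF 1).2
  rw [Fin.sum_univ_three] at h2
  linarith

/-- `2^{gain F} = F(C₁) · 2^{−(θ₀+θ₂)}`. [folklore] -/
theorem rpow_gain_eq (hF : IsUniversalSpectralPoint ℂ F) :
    (2 : ℝ) ^ gain F = F coupling₁ * (2 : ℝ) ^ (-(specMMPoint ℂ F 0 + specMMPoint ℂ F 2)) := by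
  unfold gain
  rw [Real.rpow_sub two_pos, Real.rpow_logb two_pos (by norm_num) (map_coupling₁_pos hF),
    Real.rpow_neg (by norm_num : (0:ℝ) ≤ 2), div_eq_mul_inv]

/-- **Lower gain bound: `2^{θ₁} · (1 − 2^{−(θ₀+θ₂)}) ≤ 2^{gain F}`** — the leaf `θ₁ ≤ gain F` fails at
`F` by at most the factor `1 − 2^{−(θ₀+θ₂)} ∈ [1/2, 1)`. [cite: AlmanLi2026, Prop. 4.1] -/
theorem rpow_mul_one_sub_le_rpow_gain (hF : IsUniversalSpectralPoint ℂ F) :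
    (2 : ℝ) ^ specMMPoint ℂ F 1 * (1 - (2 : ℝ) ^ (-(specMMPoint ℂ F 0 + specMMPoint ℂ F 2))) ≤
      (2 : ℝ) ^ gain F := by
  have h := rpow_sum_sub_rpow_le_map_coupling₁ hF
  have hpos : (0 : ℝ) < (2 : ℝ) ^ (-(specMMPoint ℂ F 0 + specMMPoint ℂ F 2)) :=
    Real.rpow_pos_of_pos two_pos _
  have hsum : ((2 : ℝ) ^ ∑ i, specMMPoint ℂ F i) * (2 : ℝ) ^ (-(specMMPoint ℂ F 0 + specMMPoint ℂ F 2))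
      = (2 : ℝ) ^ specMMPoint ℂ F 1 := by
    rw [← Real.rpow_add two_pos, Fin.sum_univ_three]
    ring_nf
  rw [rpow_gain_eq hF]
  have := mul_le_mul_of_nonneg_right h hpos.le
  rw [sub_mul, hsum] at this
  linarith

/-- **Upper gain bound: `2^{gain F} ≤ 2^{θ₁} · (1 + 2^{−(θ₀+θ₂)})`** — the converse `gain F ≤ θ₁`
(`BlockBelowMM` at `F`) fails by at most the factor `1 + 2^{−(θ₀+θ₂)} ∈ (1, 3/2]`.
[cite: AlmanLi2026, Prop. 4.1] -/
theorem rpow_gain_le_rpow_mul_one_add (hF : IsUniversalSpectralPoint ℂ F) :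
    (2 : ℝ) ^ gain F ≤
      (2 : ℝ) ^ specMMPoint ℂ F 1 * (1 + (2 : ℝ) ^ (-(specMMPoint ℂ F 0 + specMMPoint ℂ F 2))) := by
  have h := map_coupling₁_le_rpow_sum_add_rpow hF
  have hpos : (0 : ℝ) < (2 : ℝ) ^ (-(specMMPoint ℂ F 0 + specMMPoint ℂ F 2)) :=
    Real.rpow_pos_of_pos two_pos _
  have hsum : ((2 : ℝ) ^ ∑ i, specMMPoint ℂ F i) * (2 : ℝ) ^ (-(specMMPoint ℂ F 0 + specMMPoint ℂ F 2))
      = (2 : ℝ) ^ specMMPoint ℂ F 1 := by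
    rw [← Real.rpow_add two_pos, Fin.sum_univ_three]
    ring_nf
  rw [rpow_gain_eq hF]
  have := mul_le_mul_of_nonneg_right h hpos.le
  rw [add_mul, hsum] at this
  linarith

/-- The two factors are genuinely bounded: `2^{−(θ₀+θ₂)} ≤ 1/2`. [cite: AlmanLi2026, Prop. 4.2] -/
theorem rpow_neg_specMMPoint_add_le_half (hF : IsUniversalSpectralPoint ℂ F) :
    (2 : ℝ) ^ (-(specMMPoint ℂ F 0 + specMMPoint ℂ F 2)) ≤ 1 / 2 := by
  have h := one_le_specMMPoint_add hF
  calc (2 : ℝ) ^ (-(specMMPoint ℂ F 0 + specMMPoint ℂ F 2)) ≤ (2 : ℝ) ^ (-(1 : ℝ)) :=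
        Real.rpow_le_rpow_of_exponent_le (by norm_num) (by linarith)
    _ = 1 / 2 := by norm_num

/-- **Log form of the lower bound: `θ₁ + log₂(1 − 2^{−(θ₀+θ₂)}) ≤ gain F`** (the argument of the
logarithm lies in `[1/2, 1)`). [cite: AlmanLi2026, Prop. 4.1] -/
theorem specMMPoint_add_logb_le_gain (hF : IsUniversalSpectralPoint ℂ F) :
    specMMPoint ℂ F 1 + Real.logb 2 (1 - (2 : ℝ) ^ (-(specMMPoint ℂ F 0 + specMMPoint ℂ F 2))) ≤
      gain F := by
  have hq : (0 : ℝ) < 1 - (2 : ℝ) ^ (-(specMMPoint ℂ F 0 + specMMPoint ℂ F 2)) := by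
    linarith [rpow_neg_specMMPoint_add_le_half hF]
  have h := rpow_mul_one_sub_le_rpow_gain hF
  have h' := Real.logb_le_logb_of_le one_lt_two (mul_pos (Real.rpow_pos_of_pos two_pos _) hq) h
  rwa [Real.logb_mul (Real.rpow_pos_of_pos two_pos _).ne' hq.ne', Real.logb_rpow two_pos (by norm_num),
    Real.logb_rpow two_pos (by norm_num)] at h'

/-- **Log form of the upper bound: `gain F ≤ θ₁ + log₂(1 + 2^{−(θ₀+θ₂)}) ≤ θ₁ + log₂(3/2)`.**
[cite: AlmanLi2026, Prop. 4.1] -/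
theorem gain_le_specMMPoint_add_logb (hF : IsUniversalSpectralPoint ℂ F) :
    gain F ≤
      specMMPoint ℂ F 1 + Real.logb 2 (1 + (2 : ℝ) ^ (-(specMMPoint ℂ F 0 + specMMPoint ℂ F 2))) := by
  have hq : (0 : ℝ) < 1 + (2 : ℝ) ^ (-(specMMPoint ℂ F 0 + specMMPoint ℂ F 2)) := by
    have := Real.rpow_pos_of_pos two_pos (-(specMMPoint ℂ F 0 + specMMPoint ℂ F 2)); linarith
  have h := rpow_gain_le_rpow_mul_one_add hF
  have h' := Real.logb_le_logb_of_le one_lt_two (Real.rpow_pos_of_pos two_pos _) h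
  rwa [Real.logb_mul (Real.rpow_pos_of_pos two_pos _).ne' hq.ne', Real.logb_rpow two_pos (by norm_num),
    Real.logb_rpow two_pos (by norm_num)] at h'

/-- **The minimal counterexample pays its excess out of one letter**:
`logRatio F ≤ −log₂(1 − 2^{θ₁ − τ_F})` (`τ_F = θ₀+θ₁+θ₂ ≥ 2 > θ₁`, so the argument lies in
`(1/2, 1)`), at every universal point — in particular at the extremal point `F⋆` of
`OutsiderSandwichGluingExtremal.exists_extremal_point`, where `logRatio F⋆ = θ⋆`.
[cite: ChristandlVranaZuiddam2023, Prop. 1.6] -/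
theorem logRatio_le_neg_logb (hF : IsUniversalSpectralPoint ℂ F) :
    logRatio F ≤ -Real.logb 2 (1 - (2 : ℝ) ^ (specMMPoint ℂ F 1 - ∑ i, specMMPoint ℂ F i)) := by
  have hτ := AlmanLi2026.prop42_two_le_sum hF
  have h1 := (AlmanLi2026.prop42_mem_Icc hF 1).2
  have hlt : (2 : ℝ) ^ (specMMPoint ℂ F 1 - ∑ i, specMMPoint ℂ F i) ≤ 1 / 2 :=
    calc (2 : ℝ) ^ (specMMPoint ℂ F 1 - ∑ i, specMMPoint ℂ F i) ≤ (2 : ℝ) ^ (-(1 : ℝ)) :=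
          Real.rpow_le_rpow_of_exponent_le (by norm_num) (by linarith)
      _ = 1 / 2 := by norm_num
  have hq : (0 : ℝ) < 1 - (2 : ℝ) ^ (specMMPoint ℂ F 1 - ∑ i, specMMPoint ℂ F i) := by linarith
  have hC := map_coupling₁_pos hF
  have hM : (0 : ℝ) < F (matMulTensor ℂ 2 2 2) := by rw [map_matMul_eq_rpow hF]; positivity
  -- `F⟨2,2,2⟩ · (1 − 2^{θ₁−τ}) = F⟨2,2,2⟩ − F⟨1,2,1⟩ ≤ F(C₁)`
  have hkey : F (matMulTensor ℂ 2 2 2) * (1 - (2 : ℝ) ^ (specMMPoint ℂ F 1 - ∑ i, specMMPoint ℂ F i))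
      ≤ F coupling₁ := by
    have e : F (matMulTensor ℂ 2 2 2) * (2 : ℝ) ^ (specMMPoint ℂ F 1 - ∑ i, specMMPoint ℂ F i) =
        F (matMulTensor ℂ 1 2 1) := by
      rw [map_matMul_eq_rpow hF, map_matMul121_eq_rpow hF, ← Real.rpow_add two_pos]
      ring_nf
    rw [mul_sub, mul_one, e]
    linarith [map_matMul_le_map_coupling₁_add hF]
  -- divide: `F⟨2,2,2⟩ / F(C₁) ≤ 1 / (1 − 2^{θ₁−τ})`
  have hdiv : F (matMulTensor ℂ 2 2 2) / F coupling₁ ≤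
      (1 - (2 : ℝ) ^ (specMMPoint ℂ F 1 - ∑ i, specMMPoint ℂ F i))⁻¹ := by
    rw [div_le_iff₀ hC, inv_mul_eq_div, le_div_iff₀ hq]
    exact hkey
  unfold logRatio
  calc Real.logb 2 (F (matMulTensor ℂ 2 2 2) / F coupling₁)
      ≤ Real.logb 2 ((1 - (2 : ℝ) ^ (specMMPoint ℂ F 1 - ∑ i, specMMPoint ℂ F i))⁻¹) :=
        Real.logb_le_logb_of_le one_lt_two (div_pos hM hC) hdiv
    _ = -Real.logb 2 (1 - (2 : ℝ) ^ (specMMPoint ℂ F 1 - ∑ i, specMMPoint ℂ F i)) :=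
        Real.logb_inv _ _

/-! ## 2. The asymptotic rank of the block: `|R̃(C₁) − 2^ω| ≤ 2` -/

/-- **`2^ω − 2 ≤ R̃(C₁)`**: at a point `G` attaining `R̃⟨2,2,2⟩ = 2^ω` (Strassen duality),
`2^ω = G⟨2,2,2⟩ ≤ G(C₁) + G⟨1,2,1⟩ ≤ R̃(C₁) + 2`. [cite: ChristandlVranaZuiddam2023, Prop. 1.6] -/
theorem rpow_omega_sub_two_le_asymptoticRank_coupling₁ :
    (2 : ℝ) ^ omega ℂ - 2 ≤ asymptoticRank coupling₁ := by
  obtain ⟨G, hG, hGt⟩ := (strassen_duality_asymptoticRank_holds ℂ (matMulTensor ℂ 2 2 2)).2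
  have hω : G (matMulTensor ℂ 2 2 2) = (2 : ℝ) ^ omega ℂ := by
    rw [hGt, asymptoticRank_matMulTensor ℂ 2 (by norm_num)]
    norm_num
  have hR := (strassen_duality_asymptoticRank_holds ℂ coupling₁).1 G hG
  linarith [map_matMul_le_map_coupling₁_add hG, map_matMul121_le_two hG]

/-- **`R̃(C₁) ≤ 2^ω + 2`**: at a point `G` attaining `R̃(C₁)`,
`R̃(C₁) = G(C₁) ≤ G⟨2,2,2⟩ + G⟨1,2,1⟩ ≤ 2^ω + 2`. [cite: ChristandlVranaZuiddam2023, Prop. 1.6] -/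
theorem asymptoticRank_coupling₁_le_rpow_omega_add_two :
    asymptoticRank coupling₁ ≤ (2 : ℝ) ^ omega ℂ + 2 := by
  obtain ⟨G, hG, hGt⟩ := (strassen_duality_asymptoticRank_holds ℂ coupling₁).2
  rw [← hGt]
  linarith [map_coupling₁_le_map_matMul_add hG, map_matMul121_le_two hG, map_matMul_le_rpow_omega hG]

/-- **`|R̃(C₁) − 2^ω| ≤ 2`** — the asymptotic rank of the `4 × 4 × 4` coupled block is `2^ω` up to an
additive `2` (tree: `4 ≤ R̃(C₁) ≤ 6`; `R̃(C₁) ≤ 4 ⟹ ω = 2`, g19). [cite: ChristandlVranaZuiddam2023, Prop. 1.6] -/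
theorem abs_asymptoticRank_coupling₁_sub_rpow_omega_le :
    |asymptoticRank coupling₁ - (2 : ℝ) ^ omega ℂ| ≤ 2 := by
  rw [abs_sub_le_iff]
  constructor <;> linarith [rpow_omega_sub_two_le_asymptoticRank_coupling₁,
    asymptoticRank_coupling₁_le_rpow_omega_add_two]

end Summit.MatrixMultiplication.MatrixMultiplication.Theorems.OutsiderSandwichTraceDefectGain
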